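import Mathlib
import Literature.Analysis.FluidPDE.HardSphereDynamics
import HarnessLib

/-!
# Junk values of a hard-sphere flow off its good set

Topic `Literature/Analysis/FluidPDE`. A `HardSphereFlow G ε N` (Alexander's theorem as a hypothesis structure,
`Literature.Analysis.FluidPDE.HardSphereFlow`) constrains its flow map `Φ.flow t z` only for good initial data
`z ∈ Φ.good` (group law, trajectories) and Liouville-almost everywhere (measure preservation); off the good set the values
are junk. This file records the elementary but consequential fact that the junk is COMPLETELY FREE:

* `HardSphereFlow.withJunk Φ J hJ` — re-defining `Φ.flow t` off `Φ.good` by ANY family of measurable maps `J t` gives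
  again a `HardSphereFlow G ε N`, with the same good set, the same orbits of good points and the same Liouville
  push-forwards (`withJunk_good`, `withJunk_flow_of_mem`, `withJunk_flow_of_not_mem`, `withJunk_flow_ae_eq`);
* `HardSphereFlow.tame Φ` — the normalisation with identity junk (`flow t z = z` off `good`), always available
  (`tame_flow_of_not_mem`).

Consequences (why this matters). A statement quantifying over all `Φ : HardSphereFlow …` quantifies over all junk
branches; any predicate that reads `Φ.flow` at non-good points — e.g. the unstable plaques
`Literature.Dynamics.Billiards.localUnstableSet Φ.flow δ z`, whose membership test only looks at the backward orbit of a
point — is junk-sensitive, and refuters may choose the junk adversarially (route UGibbsSRBRigidity, item FiniteNSanity,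
2026-08-16). Conversely `tame` shows that pinning the junk to the identity costs no generality.

## References

* R. K. Alexander, *The infinite hard-sphere system*, Ph.D. thesis, Berkeley (1975); *Time evolution for infinitely many
  hard spheres*, Comm. Math. Phys. 49 (1976) [Alexander1975].
* I. Gallagher, L. Saint-Raymond, B. Texier, *From Newton to Boltzmann: hard spheres and short-range potentials*,
  EMS (2013), Prop. 4.1.1 [GST2013].
-/

noncomputable section

open MeasureTheory Set

namespace Literature.Analysis.FluidPDE

namespace HardSphereFlow

variable {d : Type*} [Fintype d] {X : Type*} [MeasureSpace X] [TopologicalSpace X] {N : ℕ} {ε : ℝ}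
  {G : Geometry d X}

/-- **Free junk.** Re-defining a hard-sphere flow off its good set by an arbitrary family of measurable maps `J t` gives
again a `HardSphereFlow` (same good set, same orbits of good points, same Liouville push-forwards): every field of the
structure speaks about good points or holds Liouville-almost everywhere. [folklore] -/
def withJunk (Φ : HardSphereFlow G ε N) (J : ℝ → Config N d X → Config N d X) (hJ : ∀ t, Measurable (J t)) :
    HardSphereFlow G ε N where
  flow t := by classical exact Φ.good.piecewise (Φ.flow t) (J t)
  good := Φ.good
  measurableSet_good := Φ.measurableSet_good
  good_subset := Φ.good_subset
  measure_compl_good := Φ.measure_compl_good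
  mapsTo_good t z hz := by
    classical
    simp only [Set.piecewise_eq_of_mem _ _ _ hz]
    exact Φ.mapsTo_good t hz
  flow_zero z hz := by
    classical
    simp only [Set.piecewise_eq_of_mem _ _ _ hz]
    exact Φ.flow_zero z hz
  flow_add s t z hz := by
    classical
    have h1 : Φ.flow t z ∈ Φ.good := Φ.mapsTo_good t hz
    rw [Set.piecewise_eq_of_mem _ _ _ hz, Set.piecewise_eq_of_mem _ _ _ hz,
      Set.piecewise_eq_of_mem _ _ _ h1]
    exact Φ.flow_add s t z hz
  measurable_flow t := by
    classical
    exact Measurable.piecewise Φ.measurableSet_good (Φ.measurable_flow t) (hJ t)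
  isTrajectory z hz := by
    classical
    have : (fun t => Φ.good.piecewise (Φ.flow t) (J t) z) = fun t => Φ.flow t z := by
      funext t
      exact Set.piecewise_eq_of_mem _ _ _ hz
    rw [this]
    exact Φ.isTrajectory z hz
  measurePreserving t := by
    classical
    have hae : Φ.good.piecewise (Φ.flow t) (J t) =ᵐ[liouville G N ε] Φ.flow t := by
      filter_upwards [Φ.ae_mem_good] with z hz
      exact Set.piecewise_eq_of_mem _ _ _ hz
    refine ⟨Measurable.piecewise Φ.measurableSet_good (Φ.measurable_flow t) (hJ t), ?_⟩
    rw [Measure.map_congr hae]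
    exact (Φ.measurePreserving t).map_eq

/-- The junked flow has the same good set. [folklore] -/
@[simp] theorem withJunk_good (Φ : HardSphereFlow G ε N) (J : ℝ → Config N d X → Config N d X)
    (hJ : ∀ t, Measurable (J t)) : (Φ.withJunk J hJ).good = Φ.good := rfl

/-- On good points the junked flow is the original flow. [folklore] -/
theorem withJunk_flow_of_mem (Φ : HardSphereFlow G ε N) (J : ℝ → Config N d X → Config N d X)
    (hJ : ∀ t, Measurable (J t)) {z : Config N d X} (hz : z ∈ Φ.good) (t : ℝ) :
    (Φ.withJunk J hJ).flow t z = Φ.flow t z := by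
  classical
  exact Set.piecewise_eq_of_mem _ _ _ hz

/-- Off the good set the junked flow is the junk branch. [folklore] -/
theorem withJunk_flow_of_not_mem (Φ : HardSphereFlow G ε N) (J : ℝ → Config N d X → Config N d X)
    (hJ : ∀ t, Measurable (J t)) {z : Config N d X} (hz : z ∉ Φ.good) (t : ℝ) :
    (Φ.withJunk J hJ).flow t z = J t z := by
  classical
  exact Set.piecewise_eq_of_notMem _ _ _ hz

/-- The junked flow agrees with the original one Liouville-almost everywhere, at every time. [folklore] -/
theorem withJunk_flow_ae_eq (Φ : HardSphereFlow G ε N) (J : ℝ → Config N d X → Config N d X)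
    (hJ : ∀ t, Measurable (J t)) (t : ℝ) : (Φ.withJunk J hJ).flow t =ᵐ[liouville G N ε] Φ.flow t := by
  filter_upwards [Φ.ae_mem_good] with z hz
  exact withJunk_flow_of_mem Φ J hJ hz t

/-- **Identity junk is always available**: the normalised flow, equal to `Φ` on the good set and to the identity off
it. [folklore] -/
def tame (Φ : HardSphereFlow G ε N) : HardSphereFlow G ε N :=
  Φ.withJunk (fun _ => id) fun _ => measurable_id

/-- The normalised flow has the same good set. [folklore] -/
@[simp] theorem tame_good (Φ : HardSphereFlow G ε N) : Φ.tame.good = Φ.good := rfl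

/-- The normalised flow is `Φ` on good points. [folklore] -/
theorem tame_flow_of_mem (Φ : HardSphereFlow G ε N) {z : Config N d X} (hz : z ∈ Φ.good) (t : ℝ) :
    Φ.tame.flow t z = Φ.flow t z :=
  withJunk_flow_of_mem Φ _ _ hz t

/-- The normalised flow has identity junk: `Φ.tame.flow t z = z` off the good set. [folklore] -/
theorem tame_flow_of_not_mem (Φ : HardSphereFlow G ε N) {z : Config N d X} (hz : z ∉ Φ.good) (t : ℝ) :
    Φ.tame.flow t z = z :=
  withJunk_flow_of_not_mem Φ _ _ hz t

end HardSphereFlow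

end Literature.Analysis.FluidPDE

end
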